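import Summits.RiemannHypothesis.RiemannHypothesis.Theses.SpectralTrace
import Summits.RiemannHypothesis.RiemannHypothesis.Theorems.WindowStep.Negative.Collapse
import Summits.RiemannHypothesis.RiemannHypothesis.Theorems.WeilWindowFlowGronwallLeakageStrictAnti
import Literature.NumberTheory.LFunctions.WeilWindowSuzukiContinuityProofs
import Literature.NumberTheory.LFunctions.WeilGroundState
import Literature.NumberTheory.LFunctions.WeilSemilocalCompactnessProofs
import HarnessLib

/-!
# Crux `WindowStep` (stmt-RiemannHypothesis-14659) — crux-ideate round 2, ideator 4 (2026-08-16)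

Sketch for the idea card `ground-state-pinning` (= "conjugate-point autopsy of the window ladder").

LEVER. A rung witness `μ = Σ δ_{γ_i}` at level `2a` is a UNIT-WEIGHT SAMPLING MEASURE for Weil's
quadratic form on the half window: `Σ_i |ĝ(1/2+iγ_i)|² = Re Q(g)` for every test `g` on `[-a, a]`
(this is the proof of `windowTraceToPositivity_proof`). Evaluated at the BOTTOM of the spectrum it
pins the ground state `u_a` (`IsWeilGroundState a u`, exists unconditionally by
`ConnesConsaniMoscovici2025_thm_3_6_holds`): `Σ_i |û(1/2+iγ_i)|² ≤ ε(a) = weilGroundEnergy a`.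
Hence at a CONJUGATE POINT `a⋆` (`ε(a⋆) = 0`; unique and terminal by the PROVED strict
antitonicity `weilGroundEnergy_lt_of_lt`) every level-`2a⋆` witness is supported on the real zeros
of `û` — a Paley–Wiener function of type `a⋆` with `O(R)` zeros in `[-R, R]` against the witness's
`≍ R log R` atoms: bounded-multiplicity witnesses are impossible there (`GapLemma`), and a
degenerate one is an explicit, essentially unique "orthogonal" integer-weighted crystal
(`NoDegenerateEdge` says it does not exist). So a rung certifies STRICT positivity / regularity of
the Weil form at its half level — a currency strictly between `WeilPositivityOn (log n / 2)`
(Horn 1) and "rebuild the rung" (Horn 2).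

CONTENTS (all `def`s are `Prop`s; the composition `windowStep_of` is sorry-free):
* `TraceClosed` — the set of window levels carrying a trace family is closed under suprema
  (RH-free; Helly + LocalWeyl, the technology of `windowCompactness_proof`);
* `CrystRegular` — from a rung, every higher level whose half level is REGULAR (`0 < ε`) is a rung
  (RH-strength, the interior half);
* `NoDegenerateEdge` — a rung level is never a conjugate level: `Trace(2a) → 0 < ε(a)`
  (RH-implied; RH-free for bounded multiplicity = `GapLemma`; Diophantine in general);
* `GroundStateSampling`, `GroundStateVanishing`, `GapLemma` — the RH-free first lemmas;
* `wtrace_above_of_rung`, `windowStep_of`, `ladder_of` — kernel-checked compositions.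
-/

set_option linter.dupNamespace false

noncomputable section

open Complex Set Filter
open scoped Topology

namespace Summit.RiemannHypothesis.RiemannHypothesis.Cruxes.WindowStep.Ideator4

open Literature.NumberTheory.LFunctions
open Summit.RiemannHypothesis.RiemannHypothesis.Theses.SpectralTrace
open Summit.RiemannHypothesis.RiemannHypothesis.Theorems
open Summit.RiemannHypothesis.RiemannHypothesis.Theorems.WindowStep.Negative
open Summit.RiemannHypothesis.RiemannHypothesis.Theorems.WeilWindowFlowGronwallLeakage

/-- File-local spelling of `Trace(A)` (verbatim the shape of `WindowTraceArch` / `WindowStep`). -/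
local notation3 "WTrace " A:max => ∃ (ι : Type) (γ : ι → ℝ), ∀ g : ℝ → ℂ, IsWeilTest g →
  tsupport g ⊆ Set.Icc (-A) A →
    HasSum (fun i => weilMellin g (1 / 2 + (γ i : ℂ) * I)) (weilFunctional g)

/-! ## The three stubs of the line -/

/-- RH-free (size M–L): the set of levels `A > 0` carrying a window-trace family is closed under
increasing limits — if every `B < A` is a rung then `A` is a rung. Proof route: the Helly /
local-Weyl compactness argument of `windowCompactness_proof` (uniform local counts
`card_near_le_log_of_windowTrace`, vague limits of integer-atomic measures are integer-atomic,
tails uniformly small by the decay of `ĝ`), run along `B_k ↑ A`, plus the dilation trick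
`g(t(1+η))` to pass from tests supported inside `(-A, A)` to tests supported in `[-A, A]`. -/
def TraceClosed : Prop :=
  ∀ A : ℝ, 0 < A → (∀ B : ℝ, 0 < B → B < A → WTrace B) → WTrace A

/-- RH-STRENGTH (the interior half of the step): from a rung at level `A`, every level `B ≥ A`
whose HALF level is regular for Weil's form (`0 < ε(B/2)`, i.e. `B/2` lies strictly before the
conjugate point) is again a rung. Integer synthesis with SPECTRAL SLACK: at such `B` the
Weil–de Branges space `H_{B/2}` (completion of the tests on `[-B/2, B/2]` under `Re Q`) is a
genuine reproducing-kernel Hilbert space of entire functions of exponential type, and the claim is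
that it carries a unit-weight Parseval frame of real reproducing kernels. RH-implied (the zero
ordinates). -/
def CrystRegular : Prop :=
  ∀ A B : ℝ, 0 < A → A ≤ B → (WTrace A) → 0 < weilGroundEnergy (B / 2) → WTrace B

/-- THE THIRD CURRENCY (RH-implied; `GapLemma` is its RH-free case): a rung at level `2a` forces
STRICT positivity of Weil's form at the half level — a rung level is never twice a conjugate
point. Equivalently (by `GroundStateVanishing`): no level-`2a⋆` witness lives on the real zeros of
the null ground state at the conjugate point `a⋆`. -/
def NoDegenerateEdge : Prop :=
  ∀ a : ℝ, 0 < a → (WTrace (2 * a)) → 0 < weilGroundEnergy a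

/-! ## First lemmas (RH-free) -/

/-- FIRST LEMMA (RH-free, size M): a level-`2a` witness SAMPLES every ground state of the window
`a` from below: `Σ_i |û(1/2+iγ_i)|² ≤ ε(a)`. Proof: for the normalised minimising tests `g_n → u`
of `IsWeilGroundState`, `Σ_i |ĝ_n(1/2+iγ_i)|² = Re Q(g_n) → ε(a)` (the witness identity on
`g_n ⋆ g̃_n`, `weilMellin_weilConv_weilReflect_half`), `ĝ_n → û` pointwise on the critical line
(`L²` convergence on a bounded window), and Fatou. (Equality holds too — the sampled form is closed —
but the inequality is what the line uses.) -/
def GroundStateSampling : Prop :=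
  ∀ a : ℝ, 0 < a → ∀ (ι : Type) (γ : ι → ℝ),
    (∀ g : ℝ → ℂ, IsWeilTest g → tsupport g ⊆ Set.Icc (-(2 * a)) (2 * a) →
      HasSum (fun i => weilMellin g (1 / 2 + (γ i : ℂ) * I)) (weilFunctional g)) →
    ∀ u : ℝ → ℂ, IsWeilGroundState a u →
      Summable (fun i => ‖weilMellin u (1 / 2 + (γ i : ℂ) * I)‖ ^ 2) ∧
        ∑' i, ‖weilMellin u (1 / 2 + (γ i : ℂ) * I)‖ ^ 2 ≤ weilGroundEnergy a

/-- RH-free corollary: at a conjugate point (`ε(a) = 0`) every level-`2a` witness is supported on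
the real zeros of (the transform of) every ground state. -/
def GroundStateVanishing : Prop :=
  ∀ a : ℝ, 0 < a → weilGroundEnergy a = 0 → ∀ (ι : Type) (γ : ι → ℝ),
    (∀ g : ℝ → ℂ, IsWeilTest g → tsupport g ⊆ Set.Icc (-(2 * a)) (2 * a) →
      HasSum (fun i => weilMellin g (1 / 2 + (γ i : ℂ) * I)) (weilFunctional g)) →
    ∀ u : ℝ → ℂ, IsWeilGroundState a u → ∀ i : ι, weilMellin u (1 / 2 + (γ i : ℂ) * I) = 0

/-- RH-free (size L): the GAP LEMMA — a level-`2a` witness of bounded multiplicity forces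
`0 < ε(a)`. Proof: `ε(a) ≥ 0` by positivity from the witness; if `ε(a) = 0`, a ground state `u`
exists (`ConnesConsaniMoscovici2025_thm_3_6_holds.exists_isWeilGroundState`), `û ≢ 0` is entire of
exponential type `≤ a` and bounded on the critical line, so Jensen's formula gives it `≤ C·(1+R)`
zeros in `|Im| ≤ R`; by `GroundStateVanishing` it vanishes at every atom, and a witness has
`≥ c R log R / M` DISTINCT atoms in `[-R, R]` (lower local Weyl law from one positive test, the
mirror image of `card_near_le_log_of_windowTrace`) — contradiction. -/
def GapLemma : Prop :=
  ∀ a : ℝ, 0 < a → ∀ (M : ℕ) (ι : Type) (γ : ι → ℝ),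
    (∀ x : ℝ, {i : ι | γ i = x}.encard ≤ M) →
    (∀ g : ℝ → ℂ, IsWeilTest g → tsupport g ⊆ Set.Icc (-(2 * a)) (2 * a) →
      HasSum (fun i => weilMellin g (1 / 2 + (γ i : ℂ) * I)) (weilFunctional g)) →
    0 < weilGroundEnergy a

/-- `GroundStateSampling` gives `GroundStateVanishing` (a `tsum` of non-negative reals that is `≤ 0`
vanishes termwise). Kernel-checked glue. -/
theorem groundStateVanishing_of_sampling (h : GroundStateSampling) : GroundStateVanishing := by
  intro a ha h0 ι γ hγ u hu i
  obtain ⟨hsum, hle⟩ := h a ha ι γ hγ u hu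
  rw [h0] at hle
  have hnn : ∀ j, 0 ≤ ‖weilMellin u (1 / 2 + (γ j : ℂ) * I)‖ ^ 2 := fun j => by positivity
  have hi_le : ‖weilMellin u (1 / 2 + (γ i : ℂ) * I)‖ ^ 2 ≤
      ∑' j, ‖weilMellin u (1 / 2 + (γ j : ℂ) * I)‖ ^ 2 :=
    hsum.le_tsum i (fun j _ => hnn j)
  have hsq : ‖weilMellin u (1 / 2 + (γ i : ℂ) * I)‖ ^ 2 = 0 :=
    le_antisymm (hi_le.trans hle) (hnn i)
  have : ‖weilMellin u (1 / 2 + (γ i : ℂ) * I)‖ = 0 := by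
    have h := sq_eq_zero_iff.1 hsq
    exact h
  exact norm_eq_zero.1 this

/-! ## The composition (kernel-checked): closedness + regular synthesis + no degenerate edge -/

/-- Continuity of `ε` on every compact range of positive windows (from the PROVED
`continuousAt_weilGroundEnergy`, Bombieri 2000 Thm 5). -/
theorem continuousOn_weilGroundEnergy_Icc {a b : ℝ} (ha : 0 < a) :
    ContinuousOn weilGroundEnergy (Icc a b) := fun _ hx =>
  (continuousAt_weilGroundEnergy (ha.trans_le hx.1)).continuousWithinAt

/-- CORE: under the three stubs, a rung at level `A₀ > 0` propagates to every level `B ≥ A₀`.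
If `ε(B/2) > 0` this is `CrystRegular`. Otherwise the intermediate value theorem (continuity,
proved) puts a conjugate point `a⋆ ∈ [A₀/2, B/2]` with `ε(a⋆) = 0`; `NoDegenerateEdge` on the rung
gives `ε(A₀/2) > 0`, strict antitonicity (`weilGroundEnergy_lt_of_lt`, proved) gives `ε > 0`
strictly before `a⋆`, so `CrystRegular` (above `A₀`) and antitonicity of the trace (below `A₀`)
make every level `< 2a⋆` a rung; `TraceClosed` makes `2a⋆` a rung, and `NoDegenerateEdge` then
says `0 < ε(a⋆) = 0`. -/
theorem wtrace_above_of_rung (hC : TraceClosed) (hR : CrystRegular) (hE : NoDegenerateEdge)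
    {A₀ : ℝ} (hA₀ : 0 < A₀) (hrung : WTrace A₀) {B : ℝ} (hB : A₀ ≤ B) : WTrace B := by
  by_cases hpos : 0 < weilGroundEnergy (B / 2)
  · exact hR A₀ B hA₀ hB hrung hpos
  · exfalso
    push Not at hpos
    -- the rung certifies regularity at its own half level
    have h0 : 0 < weilGroundEnergy (A₀ / 2) := by
      have h2 : WTrace (2 * (A₀ / 2)) := by
        have : 2 * (A₀ / 2) = A₀ := by ring
        rw [this]; exact hrung
      exact hE (A₀ / 2) (by positivity) h2
    -- a conjugate point between the two half levels
    have hle : A₀ / 2 ≤ B / 2 := by linarith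
    have hcont : ContinuousOn weilGroundEnergy (Icc (A₀ / 2) (B / 2)) :=
      continuousOn_weilGroundEnergy_Icc (by positivity)
    obtain ⟨c, hc, hc0⟩ : ∃ c ∈ Icc (A₀ / 2) (B / 2), weilGroundEnergy c = 0 :=
      intermediate_value_Icc' hle hcont ⟨hpos, h0.le⟩
    have hcpos : 0 < c := lt_of_lt_of_le (by positivity) hc.1
    -- every level below `2c` is a rung
    have hbelow : ∀ B' : ℝ, 0 < B' → B' < 2 * c → WTrace B' := by
      intro B' hB'pos hB'lt
      by_cases hcase : A₀ ≤ B'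
      · have hreg : 0 < weilGroundEnergy (B' / 2) := by
          have hlt : B' / 2 < c := by linarith
          have := weilGroundEnergy_lt_of_lt (a := B' / 2) (A := c) (by positivity) hlt
          linarith
        exact hR A₀ B' hA₀ hcase hrung hreg
      · push Not at hcase
        exact windowTrace_anti hcase.le hrung
    -- closedness puts a rung AT `2c`, and the edge stub makes `c` regular: contradiction
    have htop : WTrace (2 * c) := hC (2 * c) (by positivity) hbelow
    have := hE c hcpos htop
    linarith

/-- THE CRUX BY NAME from the three stubs (sorry-free). The rung hypothesis is consumed through
`NoDegenerateEdge` (regularity of Weil's form at `log n / 2`, which `WeilPositivityOn (log n / 2)`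
alone does not give) and through antitonicity inside the closedness step. -/
theorem windowStep_of (hC : TraceClosed) (hR : CrystRegular) (hE : NoDegenerateEdge) :
    WindowStep := by
  intro n hn hrung
  have hn' : (2 : ℝ) ≤ n := by exact_mod_cast hn
  have hA₀ : 0 < Real.log (n : ℝ) := Real.log_pos (by linarith)
  have hB : Real.log (n : ℝ) ≤ Real.log ((n : ℝ) + 1) :=
    Real.log_le_log (by linarith) (by linarith)
  exact wtrace_above_of_rung hC hR hE hA₀ hrung hB

/-- Honest accounting (Collapse-consistent): the same three stubs turn ANY rung — in particular
the seed `WindowTraceArch` — into the whole ladder, hence (with the route's `closes`) into RH.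
So `CrystRegular ∧ NoDegenerateEdge` is worth `WindowTraceArch → RH`, exactly as
`windowStep_iff_windowTraceArch_imp_riemannHypothesis` demands; the card's content is the SPLIT of
that strength into an interior synthesis statement and an edge Diophantine statement. -/
theorem ladder_of (hC : TraceClosed) (hR : CrystRegular) (hE : NoDegenerateEdge)
    (hArch : WindowTraceArch) : ∀ A : ℝ, 0 < A → WTrace A := by
  intro A hA
  have h2 : 0 < Real.log 2 := Real.log_pos (by norm_num)
  by_cases hle : Real.log 2 ≤ A
  · exact wtrace_above_of_rung hC hR hE h2 hArch hle
  · push Not at hle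
    exact windowTrace_anti hle.le hArch

/-- And conversely nothing is lost: under the three stubs `WindowStep` holds, so by Collapse the
pair (seed, stubs) is RH. -/
theorem riemannHypothesis_of (hC : TraceClosed) (hR : CrystRegular) (hE : NoDegenerateEdge)
    (hArch : WindowTraceArch) : _root_.RiemannHypothesis :=
  riemannHypothesis_of_windowTraceArch_of_windowStep hArch (windowStep_of hC hR hE)

/-- Calibration of the edge stub: it is RH-implied (under RH, `ε(a) > 0` at every window because
positivity holds at the larger window `a + 1` and `ε` is strictly antitone). So `NoDegenerateEdge`
cannot be refuted short of `¬RH`, while its bounded-multiplicity case `GapLemma` is an RH-free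
target. -/
theorem noDegenerateEdge_of_riemannHypothesis (hRH : _root_.RiemannHypothesis) :
    NoDegenerateEdge := by
  intro a ha _
  have hpos : WeilPositivityOn (a + 1) :=
    WeilPositivityOn.of_riemannHypothesis explicit_formula_holds hRH (a + 1)
  exact weilGroundEnergy_pos_of_weilPositivityOn_of_lt hpos ha (by linarith)

end Summit.RiemannHypothesis.RiemannHypothesis.Cruxes.WindowStep.Ideator4

end
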